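import Literature.NumberTheory.Rogawski1990.StableConjugacyU3
import Mathlib.LinearAlgebra.Matrix.Invertible
import Mathlib.Tactic.Group
import HarnessLib

/-!
# Stably conjugate regular elements have canonically isomorphic centralisers: `Z_{U(H)}(γ) ≃ₜ* Z_{U(H′)}(γ′)`, independent of the conjugator
(Rogawski, *Automorphic representations of unitary groups in three variables* (1990), §3.1 p. 19, §4.3 pp. 43–44: «the Haar measures on the tori
`T_γ`, `T_{γ′}` of stably conjugate regular elements are fixed compatibly» — the isomorphism along which they are compared; Langlands–Shelstad (1987), §1.3)

Topic `NumberTheory/Automorphic`; namespace `Literature.NumberTheory.Rogawski1990` (next to ★ `Corresponds` ∕ `IsStablyConj`).  DEFINITIONS WITH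
BODIES + THEOREMS (no named fact, no instance, no `sorry`).
Road (M-C) «MEASURE COHERENCE» of the F0/P3a cell (RULING #30 (3)), brick (M-C-1): the datum along which (M-C-2) states «Weil-coherent» orbital
measure families (`t γ′ = (e γ γ′)_* (t γ)`) and (M-C-4) transports covolumes.

THE POINT.  For `γ ∈ U_σ(H)(R)`, `γ′ ∈ U_σ(H′)(R)` conjugate in the common ambient `GL_n(R)` (★ `Corresponds σ H H′ γ γ′`; `IsStablyConj` when
`H′ = H`) and `γ` (hence `γ′`) REGULAR in the sense that the `GL_n(R)`-commutant of its matrix is commutative (hypothesis `hcomm`, discharged by the tree's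
commutant bricks: ★ `commute_of_charpoly_separable[_pi]`, ★ `commute_of_commute_of_charpoly_separable_of_injective`, ★ `commute_of_commute_map_of_charpoly_separable`),
conjugation by ANY `x ∈ GL_n(R)` with `x γ x⁻¹ = γ′` restricts to a group isomorphism `Z_{U(H)}(γ) ≃* Z_{U(H′)}(γ′)` that does NOT depend on `x`
(two conjugators differ by an element of the commutative `Z_{GL}(γ)`), although `x` itself is neither unitary nor canonical.  Unitarity of `x z x⁻¹`
for `H′`: it is unitary for the transported form `H″ = ᵗx̄⁻¹ H x⁻¹`, and `D = H′⁻¹ H″` commutes with `γ′` (unitary for both forms), hence with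
`x z x⁻¹` — no description of the commutant as `R[γ]` is used.

* §1 `conj_mem_unitaryGroup_of_conj_eq` (the unitarity transfer), **`Corresponds.centralizerEquiv`** (`≃*`), `Corresponds.coe_centralizerEquiv`
  ∕ **`Corresponds.coe_centralizerEquiv_eq_of_conj_eq`** (conjugator-independence), `IsStablyConj.centralizerEquiv`, and for a topological ring
  **`Corresponds.centralizerContinuousEquiv`** (`≃ₜ*`).
* The CM carriers (local `(cmDatum L N H).Local v`, adelic from rational data, archimedean `UnitaryGroup.arch`), with `hcomm` discharged from
  ★ `IsRegularElt`, are the sequel `StableCentralizerEquivCM`.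

## References
* J. D. Rogawski, *Automorphic Representations of Unitary Groups in Three Variables*, Ann. of Math. Stud. 123 (1990), §3.1 p. 19, §4.3 pp. 43–44,
  §14.1 p. 232 [Rogawski1990].
* R. P. Langlands, D. Shelstad, *On the definition of transfer factors*, Math. Ann. 278 (1987), §1.3 [LanglandsShelstad1987].
-/

noncomputable section

open NumberField IsDedekindDomain
open scoped Matrix MatrixGroups

namespace Literature.NumberTheory.Rogawski1990

open Literature.AlgebraicGeometry.ShimuraVarieties (unitaryGroup mem_unitaryGroup_iff)
open Literature.NumberTheory.Automorphic (conj_mem_unitaryGroup_of_congr matrix_congr_inv)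

/-! ## §1 Generic: a commutative ring `R` with an endomorphism `σ`, forms `H`, `H′`, corresponding regular `γ`, `γ′` -/

section General

variable {R : Type*} [CommRing R] {n : Type*} [Fintype n] [DecidableEq n] (σ : R →+* R) {H H' : Matrix n n R}

/-- **Unitarity transfers along a conjugator between corresponding regular elements.**  `H`, `H′` invertible; `γ ∈ U_σ(H)`, `γ′ ∈ U_σ(H′)`,
`x ∈ GL_n(R)` with `x γ x⁻¹ = γ′`, and the `GL_n(R)`-commutant of `γ′` commutative (`hcomm'`): every `z ∈ U_σ(H)` commuting with `γ` has
`x z x⁻¹ ∈ U_σ(H′)` (`x z x⁻¹` is unitary for `H″ = ᵗx̄⁻¹ H x⁻¹`; `D = H′⁻¹ H″` commutes with `γ′`, hence with `x z x⁻¹`).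
[cite: Rogawski1990, §3.1 p. 19] -/
theorem conj_mem_unitaryGroup_of_conj_eq (hH : IsUnit H) (hH' : IsUnit H') {γ γ' : GL n R} (hγ : γ ∈ unitaryGroup σ H)
    (hγ' : γ' ∈ unitaryGroup σ H')
    (hcomm' : ∀ B C : Matrix n n R, Commute B (γ' : Matrix n n R) → Commute C (γ' : Matrix n n R) → Commute B C)
    (x : GL n R) (hx : x * γ * x⁻¹ = γ') {z : GL n R} (hz : z ∈ unitaryGroup σ H) (hzγ : z * γ = γ * z) :
    x * z * x⁻¹ ∈ unitaryGroup σ H' := by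
  -- the transported form `H₂ = ᵗx̄⁻¹ H x⁻¹`, for which `x z x⁻¹` and `γ′ = x γ x⁻¹` are unitary
  set H₂ : Matrix n n R := (((x⁻¹ : GL n R) : Matrix n n R).map σ)ᵀ * H * ((x⁻¹ : GL n R) : Matrix n n R) with hH₂def
  have hg : ((x : Matrix n n R).map σ)ᵀ * H₂ * (x : Matrix n n R) = H := by
    have h := matrix_congr_inv σ x⁻¹ H H₂ rfl
    simpa only [inv_inv] using h
  have hw : x * z * x⁻¹ ∈ unitaryGroup σ H₂ := conj_mem_unitaryGroup_of_congr σ x H₂ H hg hz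
  have hγ₂ : γ' ∈ unitaryGroup σ H₂ := by
    rw [← hx]
    exact conj_mem_unitaryGroup_of_congr σ x H₂ H hg hγ
  -- names
  set W : Matrix n n R := ((x * z * x⁻¹ : GL n R) : Matrix n n R) with hWdef
  set Γ : Matrix n n R := (γ' : Matrix n n R) with hΓdef
  have u1 : (W.map σ)ᵀ * H₂ * W = H₂ := mem_unitaryGroup_iff.mp hw
  have u2 : (Γ.map σ)ᵀ * H' * Γ = H' := mem_unitaryGroup_iff.mp hγ'
  have u3 : (Γ.map σ)ᵀ * H₂ * Γ = H₂ := mem_unitaryGroup_iff.mp hγ₂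
  have c1 : W * Γ = Γ * W := by
    have h : (x * z * x⁻¹) * γ' = γ' * (x * z * x⁻¹) := by
      rw [← hx]
      calc (x * z * x⁻¹) * (x * γ * x⁻¹) = x * (z * γ) * x⁻¹ := by group
        _ = x * (γ * z) * x⁻¹ := by rw [hzγ]
        _ = (x * γ * x⁻¹) * (x * z * x⁻¹) := by group
    simpa only [hWdef, hΓdef, Units.val_mul] using congrArg (fun u : GL n R => (u : Matrix n n R)) h
  -- invertibility
  have hxi : IsUnit (((x⁻¹ : GL n R) : Matrix n n R)) := Units.isUnit _
  have hxiσ : IsUnit ((((x⁻¹ : GL n R) : Matrix n n R).map σ)ᵀ) := by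
    rw [Matrix.isUnit_transpose]
    simpa only [RingHom.mapMatrix_apply] using hxi.map σ.mapMatrix
  have hH₂ : IsUnit H₂ := (hxiσ.mul hH).mul hxi
  have hΓσ : IsUnit ((Γ.map σ)ᵀ) := by
    rw [Matrix.isUnit_transpose]
    simpa only [RingHom.mapMatrix_apply] using (Units.isUnit γ').map σ.mapMatrix
  have hH'det : IsUnit H'.det := (Matrix.isUnit_iff_isUnit_det H').mp hH'
  have hinv : H' * H'⁻¹ = 1 := Matrix.mul_nonsing_inv H' hH'det
  have hinv' : H'⁻¹ * H' = 1 := Matrix.nonsing_inv_mul H' hH'det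
  -- `D = H'⁻¹ H₂` commutes with `Γ`
  set D : Matrix n n R := H'⁻¹ * H₂ with hDdef
  have hH₂eq : H₂ = H' * D := by rw [hDdef, ← Matrix.mul_assoc, hinv, Matrix.one_mul]
  have hD : IsUnit D := (Matrix.isUnit_nonsing_inv_iff.mpr hH').mul hH₂
  have key : H' * Γ * H'⁻¹ * H₂ = H₂ * Γ := by
    -- from `u2`, `u3`: `ᵗΓ̄ H' Γ (H'⁻¹ H₂) = H₂ = ᵗΓ̄ H₂ Γ`, cancel `ᵗΓ̄`
    have h1 : (Γ.map σ)ᵀ * (H' * Γ * H'⁻¹ * H₂) = (Γ.map σ)ᵀ * (H₂ * Γ) := by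
      calc (Γ.map σ)ᵀ * (H' * Γ * H'⁻¹ * H₂) = ((Γ.map σ)ᵀ * H' * Γ) * (H'⁻¹ * H₂) := by
            simp only [Matrix.mul_assoc]
        _ = H₂ := by rw [u2, ← Matrix.mul_assoc, hinv, Matrix.one_mul]
        _ = (Γ.map σ)ᵀ * (H₂ * Γ) := by rw [← Matrix.mul_assoc, u3]
    exact hΓσ.mul_left_cancel h1
  have hDΓ : Commute D Γ := by
    change D * Γ = Γ * D
    calc D * Γ = H'⁻¹ * (H₂ * Γ) := by rw [hDdef, Matrix.mul_assoc]
      _ = H'⁻¹ * (H' * Γ * H'⁻¹ * H₂) := by rw [key]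
      _ = Γ * D := by simp only [← Matrix.mul_assoc, hinv', Matrix.one_mul, hDdef]
  have hDW : D * W = W * D := (hcomm' D W hDΓ c1).eq
  -- conclude
  rw [mem_unitaryGroup_iff]
  change (W.map σ)ᵀ * H' * W = H'
  have h2 : (W.map σ)ᵀ * H' * W * D = H' * D := by
    calc (W.map σ)ᵀ * H' * W * D = (W.map σ)ᵀ * H' * (D * W) := by rw [hDW, Matrix.mul_assoc]
      _ = (W.map σ)ᵀ * (H' * D) * W := by simp only [Matrix.mul_assoc]
      _ = H' * D := by rw [← hH₂eq, u1]
  exact hD.mul_right_cancel h2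

/-- **Conjugator-independence** at the level of `GL_n(R)`: if `x γ x⁻¹ = γ′ = y γ y⁻¹` and the `GL_n(R)`-commutant of `γ` is commutative,
then `x z x⁻¹ = y z y⁻¹` for every `z` commuting with `γ` (`y⁻¹ x` lies in the commutant of `γ`, so it commutes with `z`).
[cite: Rogawski1990, §3.1 p. 19] -/
theorem conj_eq_conj_of_conj_eq {γ γ' : GL n R}
    (hcomm : ∀ B C : Matrix n n R, Commute B (γ : Matrix n n R) → Commute C (γ : Matrix n n R) → Commute B C)
    {x y : GL n R} (hx : x * γ * x⁻¹ = γ') (hy : y * γ * y⁻¹ = γ') {z : GL n R} (hzγ : z * γ = γ * z) :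
    x * z * x⁻¹ = y * z * y⁻¹ := by
  have hu : (y⁻¹ * x) * γ = γ * (y⁻¹ * x) := by
    have h1 : (y⁻¹ * x) * γ * (y⁻¹ * x)⁻¹ = γ := by
      calc (y⁻¹ * x) * γ * (y⁻¹ * x)⁻¹ = y⁻¹ * (x * γ * x⁻¹) * y := by group
        _ = y⁻¹ * (y * γ * y⁻¹) * y := by rw [hx, hy]
        _ = γ := by group
    calc (y⁻¹ * x) * γ = ((y⁻¹ * x) * γ * (y⁻¹ * x)⁻¹) * (y⁻¹ * x) := by group
      _ = γ * (y⁻¹ * x) := by rw [h1]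
  have huc : Commute ((y⁻¹ * x : GL n R) : Matrix n n R) (γ : Matrix n n R) := by
    change ((y⁻¹ * x : GL n R) : Matrix n n R) * (γ : Matrix n n R) = (γ : Matrix n n R) * ((y⁻¹ * x : GL n R) : Matrix n n R)
    rw [← Units.val_mul, hu, Units.val_mul]
  have hzc : Commute (z : Matrix n n R) (γ : Matrix n n R) := by
    change (z : Matrix n n R) * (γ : Matrix n n R) = (γ : Matrix n n R) * (z : Matrix n n R)
    rw [← Units.val_mul, hzγ, Units.val_mul]
  have huz : (y⁻¹ * x) * z = z * (y⁻¹ * x) :=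
    Units.ext (by rw [Units.val_mul, Units.val_mul]; exact (hcomm _ _ huc hzc).eq)
  calc x * z * x⁻¹ = y * ((y⁻¹ * x) * z) * x⁻¹ := by group
    _ = y * (z * (y⁻¹ * x)) * x⁻¹ := by rw [huz]
    _ = y * z * y⁻¹ := by group

variable {σ}

namespace Corresponds

variable {γ : unitaryGroup σ H} {γ' : unitaryGroup σ H'}

/-- A conjugator `x ∈ GL_n(R)` with `x γ x⁻¹ = γ′` for corresponding `γ`, `γ′` (a choice; nothing below depends on it, see
`coe_centralizerEquiv_eq_of_conj_eq`). [cite: Rogawski1990, §14.1 p. 232] -/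
def conjugator (hc : Corresponds σ H H' γ γ') : GL n R :=
  (isConj_iff.mp hc).choose

/-- `x γ x⁻¹ = γ′` for the chosen conjugator `x`. [cite: Rogawski1990, §14.1 p. 232] -/
theorem conjugator_spec (hc : Corresponds σ H H' γ γ') : hc.conjugator * (γ : GL n R) * hc.conjugator⁻¹ = γ' :=
  (isConj_iff.mp hc).choose_spec

/-- `x⁻¹ γ′ x = γ` for the chosen conjugator `x`. [cite: Rogawski1990, §14.1 p. 232] -/
theorem conjugator_inv_spec (hc : Corresponds σ H H' γ γ') :
    hc.conjugator⁻¹ * (γ' : GL n R) * hc.conjugator⁻¹⁻¹ = γ := by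
  rw [← hc.conjugator_spec]
  group

/-- **`Z_{U(H)}(γ) ≃* Z_{U(H′)}(γ′)` for corresponding regular `γ`, `γ′`** (`H`, `H′` invertible; the `GL_n(R)`-commutants of `γ` and of `γ′`
commutative): `z ↦ x z x⁻¹` for a conjugator `x` — well defined into `U(H′)` by `conj_mem_unitaryGroup_of_conj_eq`, inverse `z′ ↦ x⁻¹ z′ x`,
and INDEPENDENT of `x` (`coe_centralizerEquiv_eq_of_conj_eq`).  The isomorphism `T_γ ≅ T_{γ′}` of the tori of stably conjugate regular
elements along which compatible Haar measures are fixed. [cite: Rogawski1990, §4.3 pp. 43–44] [cite: LanglandsShelstad1987, §1.3] -/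
def centralizerEquiv (hc : Corresponds σ H H' γ γ') (hH : IsUnit H) (hH' : IsUnit H')
    (hcomm : ∀ B C : Matrix n n R, Commute B ((γ : GL n R) : Matrix n n R) → Commute C ((γ : GL n R) : Matrix n n R) → Commute B C)
    (hcomm' : ∀ B C : Matrix n n R, Commute B ((γ' : GL n R) : Matrix n n R) → Commute C ((γ' : GL n R) : Matrix n n R) → Commute B C) :
    Subgroup.centralizer ({γ} : Set (unitaryGroup σ H)) ≃* Subgroup.centralizer ({γ'} : Set (unitaryGroup σ H')) where
  toFun z := ⟨⟨hc.conjugator * ((z : unitaryGroup σ H) : GL n R) * hc.conjugator⁻¹,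
      conj_mem_unitaryGroup_of_conj_eq σ hH hH' γ.2 γ'.2 hcomm' hc.conjugator hc.conjugator_spec (z : unitaryGroup σ H).2
        (congrArg Subtype.val (Subgroup.mem_centralizer_singleton_iff.mp z.2))⟩,
    Subgroup.mem_centralizer_singleton_iff.mpr (Subtype.ext (by
      change (hc.conjugator * ((z : unitaryGroup σ H) : GL n R) * hc.conjugator⁻¹) * (γ' : GL n R) =
        (γ' : GL n R) * (hc.conjugator * ((z : unitaryGroup σ H) : GL n R) * hc.conjugator⁻¹)
      have hzγ : ((z : unitaryGroup σ H) : GL n R) * γ = γ * ((z : unitaryGroup σ H) : GL n R) :=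
        congrArg Subtype.val (Subgroup.mem_centralizer_singleton_iff.mp z.2)
      rw [← hc.conjugator_spec]
      calc hc.conjugator * ((z : unitaryGroup σ H) : GL n R) * hc.conjugator⁻¹ * (hc.conjugator * γ * hc.conjugator⁻¹)
          = hc.conjugator * (((z : unitaryGroup σ H) : GL n R) * γ) * hc.conjugator⁻¹ := by group
        _ = hc.conjugator * (γ * ((z : unitaryGroup σ H) : GL n R)) * hc.conjugator⁻¹ := by rw [hzγ]
        _ = hc.conjugator * γ * hc.conjugator⁻¹ * (hc.conjugator * ((z : unitaryGroup σ H) : GL n R) * hc.conjugator⁻¹) := by group))⟩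
  invFun z' := ⟨⟨hc.conjugator⁻¹ * ((z' : unitaryGroup σ H') : GL n R) * hc.conjugator⁻¹⁻¹,
      conj_mem_unitaryGroup_of_conj_eq σ hH' hH γ'.2 γ.2 hcomm hc.conjugator⁻¹ hc.conjugator_inv_spec (z' : unitaryGroup σ H').2
        (congrArg Subtype.val (Subgroup.mem_centralizer_singleton_iff.mp z'.2))⟩,
    Subgroup.mem_centralizer_singleton_iff.mpr (Subtype.ext (by
      change (hc.conjugator⁻¹ * ((z' : unitaryGroup σ H') : GL n R) * hc.conjugator⁻¹⁻¹) * (γ : GL n R) =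
        (γ : GL n R) * (hc.conjugator⁻¹ * ((z' : unitaryGroup σ H') : GL n R) * hc.conjugator⁻¹⁻¹)
      have hzγ : ((z' : unitaryGroup σ H') : GL n R) * γ' = γ' * ((z' : unitaryGroup σ H') : GL n R) :=
        congrArg Subtype.val (Subgroup.mem_centralizer_singleton_iff.mp z'.2)
      rw [← hc.conjugator_inv_spec]
      calc hc.conjugator⁻¹ * ((z' : unitaryGroup σ H') : GL n R) * hc.conjugator⁻¹⁻¹ * (hc.conjugator⁻¹ * γ' * hc.conjugator⁻¹⁻¹)
          = hc.conjugator⁻¹ * (((z' : unitaryGroup σ H') : GL n R) * γ') * hc.conjugator⁻¹⁻¹ := by group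
        _ = hc.conjugator⁻¹ * (γ' * ((z' : unitaryGroup σ H') : GL n R)) * hc.conjugator⁻¹⁻¹ := by rw [hzγ]
        _ = hc.conjugator⁻¹ * γ' * hc.conjugator⁻¹⁻¹ * (hc.conjugator⁻¹ * ((z' : unitaryGroup σ H') : GL n R) * hc.conjugator⁻¹⁻¹) := by
            group))⟩
  left_inv z := Subtype.ext (Subtype.ext (by
    change hc.conjugator⁻¹ * (hc.conjugator * ((z : unitaryGroup σ H) : GL n R) * hc.conjugator⁻¹) * hc.conjugator⁻¹⁻¹ =
      ((z : unitaryGroup σ H) : GL n R)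
    group))
  right_inv z' := Subtype.ext (Subtype.ext (by
    change hc.conjugator * (hc.conjugator⁻¹ * ((z' : unitaryGroup σ H') : GL n R) * hc.conjugator⁻¹⁻¹) * hc.conjugator⁻¹ =
      ((z' : unitaryGroup σ H') : GL n R)
    group))
  map_mul' z w := Subtype.ext (Subtype.ext (by
    change hc.conjugator * (((z : unitaryGroup σ H) : GL n R) * ((w : unitaryGroup σ H) : GL n R)) * hc.conjugator⁻¹ =
      (hc.conjugator * ((z : unitaryGroup σ H) : GL n R) * hc.conjugator⁻¹) * (hc.conjugator * ((w : unitaryGroup σ H) : GL n R) * hc.conjugator⁻¹)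
    group))

/-- The matrix of `centralizerEquiv z` is `x z x⁻¹` for the CHOSEN conjugator. [cite: Rogawski1990, §4.3 pp. 43–44] -/
theorem coe_centralizerEquiv (hc : Corresponds σ H H' γ γ') (hH : IsUnit H) (hH' : IsUnit H')
    (hcomm : ∀ B C : Matrix n n R, Commute B ((γ : GL n R) : Matrix n n R) → Commute C ((γ : GL n R) : Matrix n n R) → Commute B C)
    (hcomm' : ∀ B C : Matrix n n R, Commute B ((γ' : GL n R) : Matrix n n R) → Commute C ((γ' : GL n R) : Matrix n n R) → Commute B C)
    (z : Subgroup.centralizer ({γ} : Set (unitaryGroup σ H))) :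
    (((hc.centralizerEquiv hH hH' hcomm hcomm' z : Subgroup.centralizer ({γ'} : Set (unitaryGroup σ H'))) : unitaryGroup σ H') : GL n R) =
      hc.conjugator * ((z : unitaryGroup σ H) : GL n R) * hc.conjugator⁻¹ :=
  rfl

/-- **Conjugator-independence**: the matrix of `centralizerEquiv z` is `y z y⁻¹` for EVERY `y ∈ GL_n(R)` with `y γ y⁻¹ = γ′`.
[cite: Rogawski1990, §4.3 pp. 43–44] [cite: LanglandsShelstad1987, §1.3] -/
theorem coe_centralizerEquiv_eq_of_conj_eq (hc : Corresponds σ H H' γ γ') (hH : IsUnit H) (hH' : IsUnit H')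
    (hcomm : ∀ B C : Matrix n n R, Commute B ((γ : GL n R) : Matrix n n R) → Commute C ((γ : GL n R) : Matrix n n R) → Commute B C)
    (hcomm' : ∀ B C : Matrix n n R, Commute B ((γ' : GL n R) : Matrix n n R) → Commute C ((γ' : GL n R) : Matrix n n R) → Commute B C)
    (y : GL n R) (hy : y * (γ : GL n R) * y⁻¹ = γ') (z : Subgroup.centralizer ({γ} : Set (unitaryGroup σ H))) :
    (((hc.centralizerEquiv hH hH' hcomm hcomm' z : Subgroup.centralizer ({γ'} : Set (unitaryGroup σ H'))) : unitaryGroup σ H') : GL n R) =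
      y * ((z : unitaryGroup σ H) : GL n R) * y⁻¹ := by
  rw [coe_centralizerEquiv]
  exact conj_eq_conj_of_conj_eq hcomm hc.conjugator_spec hy (congrArg Subtype.val (Subgroup.mem_centralizer_singleton_iff.mp z.2))

/-- The matrix of `centralizerEquiv.symm z′` is `x⁻¹ z′ x`. [cite: Rogawski1990, §4.3 pp. 43–44] -/
theorem coe_centralizerEquiv_symm (hc : Corresponds σ H H' γ γ') (hH : IsUnit H) (hH' : IsUnit H')
    (hcomm : ∀ B C : Matrix n n R, Commute B ((γ : GL n R) : Matrix n n R) → Commute C ((γ : GL n R) : Matrix n n R) → Commute B C)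
    (hcomm' : ∀ B C : Matrix n n R, Commute B ((γ' : GL n R) : Matrix n n R) → Commute C ((γ' : GL n R) : Matrix n n R) → Commute B C)
    (z' : Subgroup.centralizer ({γ'} : Set (unitaryGroup σ H'))) :
    ((((hc.centralizerEquiv hH hH' hcomm hcomm').symm z' : Subgroup.centralizer ({γ} : Set (unitaryGroup σ H))) : unitaryGroup σ H) :
        GL n R) = hc.conjugator⁻¹ * ((z' : unitaryGroup σ H') : GL n R) * hc.conjugator := by
  change hc.conjugator⁻¹ * ((z' : unitaryGroup σ H') : GL n R) * hc.conjugator⁻¹⁻¹ = _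
  rw [inv_inv]

/-- **The topological version `Z_{U(H)}(γ) ≃ₜ* Z_{U(H′)}(γ′)`** for a topological ring `R` (conjugation by a fixed `x ∈ GL_n(R)` is continuous in
both directions). [cite: Rogawski1990, §4.3 pp. 43–44] [cite: LanglandsShelstad1987, §1.3] -/
def centralizerContinuousEquiv [TopologicalSpace R] [IsTopologicalRing R] (hc : Corresponds σ H H' γ γ') (hH : IsUnit H) (hH' : IsUnit H')
    (hcomm : ∀ B C : Matrix n n R, Commute B ((γ : GL n R) : Matrix n n R) → Commute C ((γ : GL n R) : Matrix n n R) → Commute B C)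
    (hcomm' : ∀ B C : Matrix n n R, Commute B ((γ' : GL n R) : Matrix n n R) → Commute C ((γ' : GL n R) : Matrix n n R) → Commute B C) :
    Subgroup.centralizer ({γ} : Set (unitaryGroup σ H)) ≃ₜ* Subgroup.centralizer ({γ'} : Set (unitaryGroup σ H')) where
  toMulEquiv := hc.centralizerEquiv hH hH' hcomm hcomm'
  continuous_toFun := by
    refine Continuous.subtype_mk (Continuous.subtype_mk ?_ _) _
    exact (continuous_const.mul (continuous_subtype_val.comp continuous_subtype_val)).mul continuous_const
  continuous_invFun := by
    refine Continuous.subtype_mk (Continuous.subtype_mk ?_ _) _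
    exact (continuous_const.mul (continuous_subtype_val.comp continuous_subtype_val)).mul continuous_const

/-- The `≃ₜ*` has the same underlying map. [cite: Rogawski1990, §4.3 pp. 43–44] -/
theorem centralizerContinuousEquiv_apply [TopologicalSpace R] [IsTopologicalRing R] (hc : Corresponds σ H H' γ γ') (hH : IsUnit H)
    (hH' : IsUnit H')
    (hcomm : ∀ B C : Matrix n n R, Commute B ((γ : GL n R) : Matrix n n R) → Commute C ((γ : GL n R) : Matrix n n R) → Commute B C)
    (hcomm' : ∀ B C : Matrix n n R, Commute B ((γ' : GL n R) : Matrix n n R) → Commute C ((γ' : GL n R) : Matrix n n R) → Commute B C)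
    (z : Subgroup.centralizer ({γ} : Set (unitaryGroup σ H))) :
    hc.centralizerContinuousEquiv hH hH' hcomm hcomm' z = hc.centralizerEquiv hH hH' hcomm hcomm' z :=
  rfl

end Corresponds

end General

end Literature.NumberTheory.Rogawski1990
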